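import Literature.AlgebraicGeometry.HodgeTheory.CMHodgeGroupDualBases
import HarnessLib

/-!
# The `Hg = U_E` socket for a CM field `E = ℚ[φ]` of any degree, Lie form: lifting the factors `𝔰𝔩(W_σ) ⊕ 0` and the
# central idempotents into `𝔤_ℂ` gives `𝔤_ℂ ⊇ 𝔲_E(V, ψ)_ℂ` (Moonen–Zarhin 1999 (1.8)/(2.3), Ribet 1983 Thm. 0: the
# input «`Hg = U_E`» of the cell's census rows 10 / 12; Deligne LNM 900 §4)

Family `hodge`, layer `Literature/AlgebraicGeometry/HodgeTheory` (next to `CMHodgeGroupDualBases`, whose orthogonality lemma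
`CMTheta.form_eq_zero_of_ne` is the one Hodge-theoretic input). UNCONDITIONAL; theorems only, no definition, no named fact,
no `sorry`. Written for the cell `pub-hodgeav-hg6` (req-37 (A) Q2b, TABLE X rows 10 / 12 ALL MEMBERS, design note
`HOME/jobs/A7-inventory-eng5g6/DESIGN-rows10-12-allmembers.md`, bricks P5 ← P1–P4; HONEST FRAMING of that cell: HC / HC_AV /
HC_CM / H2 NOT proved — this file is linear algebra of polarized weight-one `ℚ`-Hodge structures and discharges nothing by
itself).

SETTING. `H` effective polarized of weight `1`, `ψ` a polarization, `φ ∈ End_Hdg(V)` with `End_Hdg(V) = ℚ[φ]` spanned by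
`1, φ, …, φ^{m−1}` (`hE`), eigenvalues `μ : ι → ℂ` of `φ_ℂ` (a «CM type»: `μ` injective, `μ k′ ≠ conj (μ k)`), all eigenspaces
`W_c = ker(φ_ℂ − c)`, `c ∈ {μ k, conj (μ k)}`, spanning `V_ℂ` (`htop`, as in `CMTheta.exists_adaptedDualBasis`), and an ADMISSIBLE
`𝔤 ⊆ End_ℚ(V)` (bracket-closed is not even needed here; commuting with `End_Hdg(V)`, `ψ`-skew).
* §1 **`CMThetaSocket.eq_zero_of_forall_eigenspace`** — DETERMINATION BY A CM TYPE: an operator commuting with `φ_ℂ`,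
  `ψ_ℂ`-skew and zero on every `W_{μ k}` is zero (its values on `W_{conj μ k}` pair only with `W_{μ k}`, where skewness moves it
  to the other argument; the tree's `QuarticTheta.eq_zero_of_forall_eigenspace` for two blocks, here for any `ι`).
* §2 **`CMThetaSocket.mem_spanC_of_lift_of_centre`** — THE SOCKET: if (LIFT) for every `k` every TRACELESS endomorphism of
  `W_{μ k}` is the restriction of an element of `𝔤_ℂ` vanishing on the other `W_{μ j}`, and (CENTRE) for every `k` some element
  of `𝔤_ℂ` is `1` on `W_{μ k}` and `0` on the other `W_{μ j}`, then EVERY `φ_ℂ`-commuting `ψ_ℂ`-skew operator lies in `𝔤_ℂ` —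
  i.e. `𝔤_ℂ ⊇ 𝔲_E(V,ψ)_ℂ ≅ ∏_k 𝔤𝔩(W_{μ k})`, the hypothesis `hU` of the cell's census rows 10 / 12 (L14 / L15) and of
  `AVSlots.isDivisorGenerated_of_hodgeLieC_{quarticCM, cmField}` (G2d / G3b). For rows 10 / 12 the LIFT input is the lift
  alternative of the tree's `LieGoursatTwist.exists_eq_single_or_exists_twist_of_lieHom` (P1/P1b) once its twist alternative
  is excluded (brick P3) and the per-`σ` projections are onto (P2), and CENTRE is brick P4 — see the design note; nothing of
  that is claimed here.

## References
* [MoonenZarhin1999LowDim] B. Moonen, Yu. Zarhin, Math. Ann. 315 (1999), §1 (1.8), §2 (2.3).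
* [Ribet1983] K. A. Ribet, Amer. J. Math. 105 (1983), Thm. 0.
* [Deligne1982HodgeCycles] P. Deligne, LNM 900 (1982), I §3 Prop. 3.4, §4 (p. 30: `H¹ ⊗ ℂ = ⊕_σ H¹_σ`, `ψ` pairs `H¹_σ` with
  `H¹_σ̄`).
* [Gordon1997] B. B. Gordon, arXiv:alg-geom/9709030, §6 (proof of Thm. 6.3.3, pp. 18–19: `MT(A,ℂ) → ∏ GL(W_σ)`).
-/

noncomputable section

open scoped TensorProduct
open Module

namespace Literature.AlgebraicGeometry.Motives

namespace HodgeStructure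

universe u

variable {V : Type u} [AddCommGroup V] [Module ℚ V] {n : ℤ}

/-! ### §1 Determination by a CM type -/

/-- **An operator commuting with `φ_ℂ`, `ψ_ℂ`-skew and zero on every `W_{μ k}` of a CM type is zero.** For `x ∈ W_{conj μ k}`,
`D x ∈ W_{conj μ k}` pairs trivially with every `W_c`, `c ≠ μ k` (`CMTheta.form_eq_zero_of_ne`: the Rosati involution is complex
conjugation on `E = ℚ[φ]`), and with `W_{μ k}` by skewness (`D = 0` there); `ψ_ℂ` is non-degenerate and the `W_c` span `V_ℂ`.
(The tree's `QuarticTheta.eq_zero_of_forall_eigenspace`, any number of blocks.) [cite: Deligne1982HodgeCycles, §4 (p. 30)]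
[cite: Gordon1997, §6 (proof of Thm. 6.3.3, p. 19)] -/
theorem CMThetaSocket.eq_zero_of_forall_eigenspace [Module.Finite ℚ V] [HodgeTensorFacts.{u, u}] {ι : Type}
    (H : HodgeStructure V n) (hn : n = 1) (heff : H.IsEffective) (ψ : H.Polarization) {φ : Module.End ℚ V}
    (hφE : φ ∈ H.endAlg) {m : ℕ} (hE : ∀ a ∈ H.endAlg, ∃ q : Fin m → ℚ, a = ∑ k, q k • φ ^ (k : ℕ)) (μ : ι → ℂ)
    (hinj : Function.Injective μ) (hdist : ∀ k k', μ k' ≠ starRingEnd ℂ (μ k))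
    (htop : (⨆ kt : ι × Fin 2, Module.End.eigenspace (φ.baseChange ℂ)
      (if kt.2 = 0 then μ kt.1 else starRingEnd ℂ (μ kt.1))) = ⊤)
    {D : Module.End ℂ (ℂ ⊗[ℚ] V)} (hDφ : D * φ.baseChange ℂ = φ.baseChange ℂ * D)
    (hDskew : ∀ x y, ψ.form.baseChange ℂ (D x) y + ψ.form.baseChange ℂ x (D y) = 0)
    (hD : ∀ k, ∀ w ∈ Module.End.eigenspace (φ.baseChange ℂ) (μ k), D w = 0) : D = 0 := by
  classical
  set F := φ.baseChange ℂ with hF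
  set ψC := ψ.form.baseChange ℂ with hψC
  have horth : ∀ {a b : ℂ}, a ≠ starRingEnd ℂ b → ∀ {x y : ℂ ⊗[ℚ] V},
      x ∈ Module.End.eigenspace F a → y ∈ Module.End.eigenspace F b → ψC x y = 0 :=
    fun hab _ _ hx hy => CMTheta.form_eq_zero_of_ne H hn heff ψ hφE hE hab hx hy
  have hDW : ∀ c, ∀ w ∈ Module.End.eigenspace F c, D w ∈ Module.End.eigenspace F c := fun c w hw =>
    UnitaryTheta.apply_mem_eigenspace_of_commute hDφ hw
  -- `D` kills every `W_{conj μ k}`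
  have hD' : ∀ k, ∀ y ∈ Module.End.eigenspace F (starRingEnd ℂ (μ k)), D y = 0 := by
    intro k y hy
    have hDy := hDW _ y hy
    refine ψ.eq_zero_of_forall_form_eq_zero fun x => ?_
    -- `ψ_ℂ(D y, x) = 0` for `x` in each eigenspace, hence for all `x`
    have hx : x ∈ ⨆ kt : ι × Fin 2, Module.End.eigenspace F
        (if kt.2 = 0 then μ kt.1 else starRingEnd ℂ (μ kt.1)) := by rw [htop]; exact Submodule.mem_top
    refine Submodule.iSup_induction (motive := fun x => ψC (D y) x = 0) _ hx ?_ (by simp only [map_zero])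
      (fun x x' hx hx' => by simp only [map_add, hx, hx', add_zero])
    rintro ⟨j, t⟩ x hx
    by_cases ht : t = 0
    · rw [if_pos ht] at hx
      by_cases hjk : j = k
      · subst hjk
        -- skewness moves `D` onto `x ∈ W_{μ j}`, where it vanishes
        have h := hDskew y x
        rwa [hD j x hx, map_zero, add_zero] at h
      · exact horth (a := starRingEnd ℂ (μ k)) (b := μ j)
          (fun h => hjk (hinj ((starRingEnd ℂ).injective h)).symm) hDy hx
    · rw [if_neg ht] at hx
      exact horth (a := starRingEnd ℂ (μ k)) (b := starRingEnd ℂ (μ j))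
        (fun h => hdist k j (by rw [starRingEnd_self_apply] at h; exact h.symm)) hDy hx
  -- `D` vanishes on every eigenspace, hence on their span `V_ℂ`
  refine LinearMap.ext fun v => ?_
  have hv : v ∈ ⨆ kt : ι × Fin 2, Module.End.eigenspace F
      (if kt.2 = 0 then μ kt.1 else starRingEnd ℂ (μ kt.1)) := by rw [htop]; exact Submodule.mem_top
  rw [LinearMap.zero_apply]
  refine Submodule.iSup_induction (motive := fun x => D x = 0) _ hv ?_ (by simp only [map_zero])
    (fun x x' hx hx' => by simp only [map_add, hx, hx', add_zero])
  rintro ⟨j, t⟩ x hx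
  by_cases ht : t = 0
  · rw [if_pos ht] at hx
    exact hD j x hx
  · rw [if_neg ht] at hx
    exact hD' j x hx

/-- The traceless part of an endomorphism: `T = Z + c·1` with `tr Z = 0` (`c = tr T / dim`; any `c` if `dim = 0`). [folklore] -/
private theorem CMThetaSocket.exists_traceless_part {K M : Type*} [Field K] [CharZero K] [AddCommGroup M] [Module K M]
    [FiniteDimensional K M] (T : Module.End K M) :
    ∃ (Z : Module.End K M) (c : K), LinearMap.trace K M Z = 0 ∧ ∀ w, Z w = T w - c • w := by
  by_cases h0 : Module.finrank K M = 0
  · haveI : Subsingleton M := Module.finrank_zero_iff.1 h0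
    exact ⟨T, 0, by rw [Subsingleton.elim T 0, map_zero], fun w => by rw [zero_smul, sub_zero]⟩
  · refine ⟨T - (LinearMap.trace K M T / (Module.finrank K M : K)) • 1, LinearMap.trace K M T / (Module.finrank K M : K),
      ?_, fun w => by rw [LinearMap.sub_apply, LinearMap.smul_apply, Module.End.one_apply]⟩
    rw [map_sub, map_smul, LinearMap.trace_one, smul_eq_mul, div_mul_cancel₀ _ (Nat.cast_ne_zero.2 h0), sub_self]

/-! ### §2 The socket: lifts of the traceless factors and of the central idempotents give `𝔤_ℂ ⊇ 𝔲_E(V,ψ)_ℂ` -/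

/-- **THE `Hg = U_E` SOCKET (Lie form).** `H` effective polarized of weight `1`, `E = End_Hdg(V) = ℚ[φ]`, `μ : ι → ℂ` a CM type of
eigenvalues of `φ_ℂ` whose `2|ι|` eigenspaces span `V_ℂ`, `𝔤 ⊆ End_ℚ(V)` commuting with `End_Hdg(V)` and `ψ`-skew. If
(LIFT) for every `k` and every traceless `Z ∈ End(W_{μ k})` some `X ∈ 𝔤_ℂ` restricts to `Z` on `W_{μ k}` and to `0` on the other
`W_{μ j}`, and (CENTRE) for every `k` some `C ∈ 𝔤_ℂ` is the identity on `W_{μ k}` and `0` on the other `W_{μ j}`, then every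
`φ_ℂ`-commuting `ψ_ℂ`-skew operator `Y` lies in `𝔤_ℂ`: `Y|_{W_{μ k}} = (Y|_{W_{μ k}} − c_k·1) + c_k·1` with
`c_k = tr(Y|_{W_{μ k}})/dim W_{μ k}` is matched on every `W_{μ k}` by `Σ_k (X_k + c_k C_k) ∈ 𝔤_ℂ`, and §1 concludes. This is
«`Lie Hg ⊗ ℂ ⊇ 𝔲_E(V,ψ) ⊗ ℂ = ∏_σ 𝔤𝔩(W_σ)`» (MZ99 (1.8) `Hg = U_E`) in the form consumed by the cell's census rows 10 / 12.
[cite: MoonenZarhin1999LowDim, §1 (1.8) and §2 (2.3)] [cite: Ribet1983, Thm. 0] [cite: Gordon1997, §6 (pp. 18–19)]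
[cite: Deligne1982HodgeCycles, I §3 Prop. 3.4 and §4] -/
theorem CMThetaSocket.mem_spanC_of_lift_of_centre [Module.Finite ℚ V] [HodgeTensorFacts.{u, u}] {ι : Type} [Fintype ι]
    [DecidableEq ι] (H : HodgeStructure V n) (hn : n = 1) (heff : H.IsEffective) (ψ : H.Polarization)
    {φ : Module.End ℚ V} (hφE : φ ∈ H.endAlg) {m : ℕ} (hE : ∀ a ∈ H.endAlg, ∃ q : Fin m → ℚ, a = ∑ k, q k • φ ^ (k : ℕ))
    (μ : ι → ℂ) (hinj : Function.Injective μ) (hdist : ∀ k k', μ k' ≠ starRingEnd ℂ (μ k))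
    (htop : (⨆ kt : ι × Fin 2, Module.End.eigenspace (φ.baseChange ℂ)
      (if kt.2 = 0 then μ kt.1 else starRingEnd ℂ (μ kt.1))) = ⊤)
    (𝔤 : Submodule ℚ (Module.End ℚ V))
    (hcomm : ∀ X ∈ 𝔤, ∀ a : H.endAlg, X * (a : Module.End ℚ V) = (a : Module.End ℚ V) * X)
    (hskew : ∀ X ∈ 𝔤, ∀ v w, ψ.form (X v) w + ψ.form v (X w) = 0)
    (hlift : ∀ k, ∀ Z : Module.End ℂ ↥(Module.End.eigenspace (φ.baseChange ℂ) (μ k)),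
      LinearMap.trace ℂ _ Z = 0 → ∃ X ∈ spanC 𝔤,
        (∀ w : ↥(Module.End.eigenspace (φ.baseChange ℂ) (μ k)), X w = Z w) ∧
        ∀ j, j ≠ k → ∀ w ∈ Module.End.eigenspace (φ.baseChange ℂ) (μ j), X w = 0)
    (hcentre : ∀ k, ∃ C ∈ spanC 𝔤, (∀ w ∈ Module.End.eigenspace (φ.baseChange ℂ) (μ k), C w = w) ∧
        ∀ j, j ≠ k → ∀ w ∈ Module.End.eigenspace (φ.baseChange ℂ) (μ j), C w = 0)
    {Y : Module.End ℂ (ℂ ⊗[ℚ] V)} (hYφ : Y * φ.baseChange ℂ = φ.baseChange ℂ * Y)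
    (hYskew : ∀ x y, ψ.form.baseChange ℂ (Y x) y + ψ.form.baseChange ℂ x (Y y) = 0) : Y ∈ spanC 𝔤 := by
  classical
  set F := φ.baseChange ℂ with hF
  have hYW : ∀ k, ∀ w ∈ Module.End.eigenspace F (μ k), Y w ∈ Module.End.eigenspace F (μ k) := fun k w hw =>
    UnitaryTheta.apply_mem_eigenspace_of_commute hYφ hw
  -- on each `W_{μ k}`: lift the traceless part of `Y|_{W_{μ k}}`
  have key : ∀ k, ∃ X ∈ spanC 𝔤, ∃ ck : ℂ, (∀ w ∈ Module.End.eigenspace F (μ k), X w = Y w - ck • w) ∧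
      ∀ j, j ≠ k → ∀ w ∈ Module.End.eigenspace F (μ j), X w = 0 := by
    intro k
    obtain ⟨Z, ck, hZtr, hZw⟩ := CMThetaSocket.exists_traceless_part (Y.restrict (hYW k))
    obtain ⟨X, hX𝔤, hXk, hXj⟩ := hlift k Z hZtr
    refine ⟨X, hX𝔤, ck, fun w hw => ?_, hXj⟩
    rw [hXk ⟨w, hw⟩, hZw, Submodule.coe_sub, Submodule.coe_smul, LinearMap.coe_restrict_apply]
  choose X hX𝔤 c hXk hXj using key
  choose C hC𝔤 hCk hCj using hcentre
  set S : Module.End ℂ (ℂ ⊗[ℚ] V) := ∑ k, (X k + c k • C k) with hS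
  have hS𝔤 : S ∈ spanC 𝔤 :=
    Submodule.sum_mem _ fun k _ => Submodule.add_mem _ (hX𝔤 k) (Submodule.smul_mem _ _ (hC𝔤 k))
  -- `S = Y` on every `W_{μ k}`
  have hSY : ∀ k, ∀ w ∈ Module.End.eigenspace F (μ k), S w = Y w := by
    intro k w hw
    rw [hS, LinearMap.sum_apply, Finset.sum_eq_single k]
    · rw [LinearMap.add_apply, LinearMap.smul_apply, hCk k w hw, hXk k w hw, sub_add_cancel]
    · intro j _ hjk
      rw [LinearMap.add_apply, LinearMap.smul_apply, hXj j k (Ne.symm hjk) w hw, hCj j k (Ne.symm hjk) w hw, smul_zero,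
        add_zero]
    · intro h; exact absurd (Finset.mem_univ k) h
  -- `D = S − Y` is `φ_ℂ`-commuting, `ψ_ℂ`-skew and zero on the CM type, hence zero
  have hD := CMThetaSocket.eq_zero_of_forall_eigenspace H hn heff ψ hφE hE μ hinj hdist htop (D := S - Y)
    (by rw [sub_mul, mul_sub, UnitaryTheta.commute_of_mem_spanC H hφE hcomm hS𝔤, hYφ])
    (fun x y => by
      have h3 := ThetaSubalgebra.formBaseChange_add_eq_zero_of_mem_spanC ψ hskew hS𝔤 x y
      have h4 := hYskew x y
      rw [LinearMap.sub_apply, LinearMap.sub_apply, map_sub, LinearMap.sub_apply, map_sub]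
      linear_combination h3 - h4)
    (fun k w hw => by rw [LinearMap.sub_apply, hSY k w hw, sub_self])
  rw [sub_eq_zero] at hD
  exact hD ▸ hS𝔤

end HodgeStructure

end Literature.AlgebraicGeometry.Motives

end
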